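import Summits.QuantumFields.BalabanUV.Beta.EriceFlowEnclosureLogMeanClockIntegralLimit

/-!
# Beta / EriceFlowEnclosureLogMeanClockIntegralEnd — THE TWO LOGARITHMIC AVERAGES ARE ONE (END): along ANY clock sequence `n·h_n → L₀ > 0`,
# for M bounded, continuous and log-Lipschitz on ]0, δ[ and `0 < c < δ`,
#     **`(Σ_{n<N} M(h_n)∕(n+1))∕H_N − (∫_{h_N}^{c} M(s) ds∕s)∕log(c∕h_N) → 0`**,
# and, passing from the clock sequence to the continuous parameter,
#     **`(Σ_{n<N} M(h_n)∕(n+1))∕H_N → m  ⟺  (∫_h^{c} M ds∕s)∕log(c∕h) → m as h → 0⁺`** —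
# the LOGARITHMIC CUTOFF AVERAGE of the samples (P2 #54e–#54g: discrete, uniform in `log n` = log log cutoff) and the LOG-SCALE AVERAGE of M
# (P2 #54j∕#54k: continuous, uniform in `log s`) are ONE summability method read on the two sides of the clock.  Consequently gen 37's two escapes
# (P2 #54g `logCutoffAverage_escapes`, P2 #54j `logScaleAverage_escapes` — both `sin ∘ log`) are one phenomenon and its two inclusions
# (P2 #54e `logMean_of_cesaro` for the samples, P2 #54k `logScaleAverage_of_cesaroScale` for M) one inclusion; the square of gen 36∕37 closes:
#     cutoff average ⟷ harmonic scale average (P2 #53j)   ⟹   logarithmic cutoff average ⟷ log-scale average (this file),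
# the left column Tauberian-rigid along the clock (P2 #53b), the right column not (gen 37), with ONE honest Tauberian class on the right —
# power-scale slow decrease (Móricz Cor. 3 for the samples, P2 #54i; Cor. 1 for M, P2 #55d).  Pure [folklore]; by name over P2 #55b
# (`logCutoffAverage_sub_tendsto_zero`, `ideal_logCutoffAverage_sub_logScale_tendsto_zero`, `logScale_two_point(_abs)`,
# `logCutoffAverage_clock_independent`), P2 #53b (`clock_tendsto_zero`, `clock_nhdsWithin`), P2 #54g `escape_clock`.
#   §1 END **`logCutoffAverage_sub_logScale_tendsto_zero`** (two clocks + the ideal clock + two points), **`logCutoffAverage_iff_logScaleSeq`**;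
#   §2 FROM THE CLOCK TO 0⁺: **`logScale_tendsto_of_idealClock`** (`L(L₀∕(N+1)) → m ⟹ L → m at 0⁺`: for small h the ideal coupling
#      `t(h) = L₀∕(⌊L₀∕h⌋+1) ∈ [h∕2, h[` is within `2B·log 2∕log(c∕h)` of h in L), `logScale_iff_idealClock`;
#   §3 END **`logCutoffAverage_iff_logScaleAverage`** (any clock ⟺ the full limit at 0⁺).
# (β-flow team, prover 2 = lower ∕ positivity side, unit `b2b-balaban-beta-bflow-p2`, gen 38; module P2 #55c; no Erice sentence occurs)

HONEST FRAMING (page 1 of everything the β sub-cell writes): discharging `BetaPertH` makes Bałaban's UV stability UNCONDITIONAL — a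
real constructive-QFT result; it is NOT the continuum limit and NOT the Clay problem.  HONEST DEPENDENCY (cell reorg 2026-08-19,
verbatim): «continuum YM on T⁴ ⇐ BetaPertH ∧ nine spine estimates (0/9 proved); BetaPertH ⇐ (D1) ∧ (D4) ∧ CAP+tail; G-an2-4 gates
asym, D1 and NE2/3/4.»  THIS MODULE DISCHARGES NOTHING and quotes nothing: [folklore] real analysis (Hardy, Divergent Series §§3.8, 4.16: the
second theorem of consistency between the discrete logarithmic method (ℓ) and the Riesz typical mean (R, log n, 1), here in the coupling at 0⁺
and along a perturbed clock; «cutoff average ∕ datum» are OUR READINGS of (3.76)'s O(1) term, rows L119–L154, hypotheses on the LIMIT β).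

WHAT THIS FILE PROVES (0 sorry, 0 def): §1 END **`logCutoffAverage_sub_logScale_tendsto_zero`**, **`logCutoffAverage_iff_logScaleSeq`**;
§2 **`logScale_tendsto_of_idealClock`**, `logScale_iff_idealClock`; §3 END **`logCutoffAverage_iff_logScaleAverage`**.
NOT CLAIMED: rates along a general clock; the Tauberian class BY NAME at 0⁺ (P2 #55d); the (3.76) letter version by name over rows L120 ∕ L122
(routine: P2 #54h with the present END); `BetaPertH`; continuum; Clay.
-/

namespace Summit.QuantumFields.BalabanUV.Beta.EriceFlowEnclosureLogMeanClockIntegralEnd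

open Set Filter Topology MeasureTheory intervalIntegral
open Summit.QuantumFields.BalabanUV.Beta.EriceFlowEnclosureCesaroClockSampling (clock_tendsto_zero clock_nhdsWithin)
open Summit.QuantumFields.BalabanUV.Beta.EriceFlowEnclosureWeightedClockSampling (escape_clock)
open Summit.QuantumFields.BalabanUV.Beta.EriceFlowEnclosureLogMeanClockIntegralLimit

noncomputable section

variable {M : ℝ → ℝ} {δ C B L₀ : ℝ}

/-! ## §1 Any clock: the two logarithmic averages are one -/

/-- **END — THE LOGARITHMIC CUTOFF AVERAGE IS THE LOG-SCALE AVERAGE AT THE CURRENT COUPLING, UP TO o(1).**  Let M be continuous on ]0, δ[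
with `|M| ≤ B` and `|M u − M t| ≤ C·log(u∕t)` (0 < t ≤ u < δ; C ≥ 0); let `h_n > 0` with the clock `n·h_n → L₀ > 0`; let `0 < c < δ`.  Then
**`(Σ_{n<N} M(h_n)∕(n+1))∕H_N − (∫_{h_N}^{c} M(s) ds∕s)∕log(c∕h_N) → 0`**. [folklore] -/
theorem logCutoffAverage_sub_logScale_tendsto_zero (hδ : 0 < δ) (hC : 0 ≤ C) (hcont : ContinuousOn M (Ioo 0 δ))
    (hlip : ∀ t u : ℝ, 0 < t → t ≤ u → u < δ → |M u - M t| ≤ C * Real.log (u / t))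
    (hB : ∀ s ∈ Ioo 0 δ, |M s| ≤ B) {h : ℕ → ℝ} (hpos : ∀ n, 0 < h n) (hL₀ : 0 < L₀)
    (hclock : Tendsto (fun n : ℕ => (n : ℝ) * h n) atTop (𝓝 L₀)) {c : ℝ} (hc0 : 0 < c) (hcδ : c < δ) :
    Tendsto (fun N : ℕ =>
      (∑ n ∈ Finset.range N, ((n : ℝ) + 1)⁻¹ * M (h n)) / (∑ n ∈ Finset.range N, ((n : ℝ) + 1)⁻¹)
        - (∫ s in (h N)..c, M s / s) / Real.log (c / h N)) atTop (𝓝 0) := by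
  obtain ⟨hipos, hiclock⟩ := escape_clock hL₀
  have hB0 : 0 ≤ B := (abs_nonneg _).trans (hB c ⟨hc0, hcδ⟩)
  -- T1: two clocks
  have hT1 := logCutoffAverage_sub_tendsto_zero hδ hlip hpos hipos hL₀ hclock hiclock
  -- T2: the ideal clock
  have hT2 := ideal_logCutoffAverage_sub_logScale_tendsto_zero (L₀ := L₀) hδ hL₀ hC hcont hlip hB hc0 hcδ
  -- T3: two points t_N = L₀/(N+1) and h_N
  have hratio : Tendsto (fun N : ℕ => L₀ / (((N:ℝ) + 1)) / h N) atTop (𝓝 1) := by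
    have h1 : Tendsto (fun N : ℕ => ((N:ℝ) + 1) * h N) atTop (𝓝 L₀) := by
      have := hclock.add (clock_tendsto_zero hclock)
      rw [add_zero] at this
      exact this.congr fun N => by ring
    have h2 := (tendsto_const_nhds (x := L₀)).div h1 hL₀.ne'
    rw [div_self hL₀.ne'] at h2
    exact h2.congr fun N => by simp only [Pi.div_apply]; rw [div_div]
  have hlog : Tendsto (fun N : ℕ => 2 * B * |Real.log (L₀ / ((N:ℝ) + 1) / h N)|) atTop (𝓝 0) := by
    have h1 := (Real.continuousAt_log one_ne_zero).tendsto.comp hratio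
    rw [Real.log_one] at h1
    have h2 := (continuous_abs.tendsto 0).comp h1
    rw [abs_zero] at h2
    have h3 := h2.const_mul (2 * B)
    rwa [mul_zero] at h3
  have hce : 0 < c * Real.exp (-1) := by positivity
  have hT3 : Tendsto (fun N : ℕ => (∫ s in (L₀ / ((N : ℝ) + 1))..c, M s / s) / Real.log (c / (L₀ / ((N : ℝ) + 1)))
      - (∫ s in (h N)..c, M s / s) / Real.log (c / h N)) atTop (𝓝 0) := by
    refine squeeze_zero_norm' ?_ hlog
    filter_upwards [(clock_tendsto_zero hiclock).eventually (ge_mem_nhds hce),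
      (clock_tendsto_zero hclock).eventually (ge_mem_nhds hce)] with N hNi hNh
    rw [Real.norm_eq_abs]
    exact logScale_two_point_abs hcont hB hcδ (hipos N) hNi (hpos N) hNh
  have hsum := (hT1.add hT2).add hT3
  rw [add_zero, add_zero] at hsum
  exact hsum.congr fun N => by ring

/-- **COROLLARY — ONE NUMBER, TWO LOGARITHMIC CLOCKS**: under the same hypotheses, for every m:
**`(Σ_{n<N} M(h_n)∕(n+1))∕H_N → m ⟺ (∫_{h_N}^{c} M ds∕s)∕log(c∕h_N) → m`** — the logarithmic cutoff average converges iff P2 #54j's log-scale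
average converges ALONG THE COUPLINGS, to the same limit. [folklore] -/
theorem logCutoffAverage_iff_logScaleSeq (hδ : 0 < δ) (hC : 0 ≤ C) (hcont : ContinuousOn M (Ioo 0 δ))
    (hlip : ∀ t u : ℝ, 0 < t → t ≤ u → u < δ → |M u - M t| ≤ C * Real.log (u / t))
    (hB : ∀ s ∈ Ioo 0 δ, |M s| ≤ B) {h : ℕ → ℝ} (hpos : ∀ n, 0 < h n) (hL₀ : 0 < L₀)
    (hclock : Tendsto (fun n : ℕ => (n : ℝ) * h n) atTop (𝓝 L₀)) {c : ℝ} (hc0 : 0 < c) (hcδ : c < δ) (m : ℝ) :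
    Tendsto (fun N : ℕ => (∑ n ∈ Finset.range N, ((n : ℝ) + 1)⁻¹ * M (h n)) / (∑ n ∈ Finset.range N, ((n : ℝ) + 1)⁻¹))
        atTop (𝓝 m) ↔
      Tendsto (fun N : ℕ => (∫ s in (h N)..c, M s / s) / Real.log (c / h N)) atTop (𝓝 m) := by
  have hD := logCutoffAverage_sub_logScale_tendsto_zero hδ hC hcont hlip hB hpos hL₀ hclock hc0 hcδ
  constructor
  · intro h1
    have := h1.sub hD
    rw [sub_zero] at this
    exact this.congr fun N => by ring
  · intro h2
    have := hD.add h2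
    rw [zero_add] at this
    exact this.congr fun N => by ring


/-! ## §2 From the clock sequence to the full limit at 0⁺ -/

/-- **FROM THE IDEAL CLOCK TO 0⁺.**  M continuous on ]0, δ[ with `|M| ≤ B`, L₀ > 0, `0 < c < δ`, `L(x) = (∫_x^c M ds∕s)∕log(c∕x)`.  If
`L(L₀∕(N+1)) → m` then **`L(h) → m` as h → 0⁺**: for `0 < h ≤ min(L₀, c∕e)` the ideal coupling `t(h) = L₀∕(⌊L₀∕h⌋ + 1)` lies in `[h∕2, h]`, so
`|L(t(h)) − L(h)| ≤ 2B·log 2∕log(c∕h) → 0` (P2 #55b `logScale_two_point`), while `⌊L₀∕h⌋ → ∞`. [folklore] -/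
theorem logScale_tendsto_of_idealClock (hcont : ContinuousOn M (Ioo 0 δ)) (hB : ∀ s ∈ Ioo 0 δ, |M s| ≤ B)
    (hL₀ : 0 < L₀) {c : ℝ} (hc0 : 0 < c) (hcδ : c < δ) {m : ℝ}
    (hseq : Tendsto (fun N : ℕ => (∫ s in (L₀ / ((N : ℝ) + 1))..c, M s / s) / Real.log (c / (L₀ / ((N : ℝ) + 1))))
      atTop (𝓝 m)) :
    Tendsto (fun x => (∫ s in x..c, M s / s) / Real.log (c / x)) (𝓝[>] 0) (𝓝 m) := by
  have hB0 : 0 ≤ B := (abs_nonneg _).trans (hB c ⟨hc0, hcδ⟩)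
  -- N(x) := ⌊L₀/x⌋ → ∞ as x → 0⁺, so L(t(x)) → m
  have hN : Tendsto (fun x : ℝ => ⌊L₀ / x⌋₊) (𝓝[>] 0) atTop := by
    have h1 : Tendsto (fun x : ℝ => L₀ / x) (𝓝[>] 0) atTop :=
      Tendsto.const_mul_atTop hL₀ tendsto_inv_nhdsGT_zero |>.congr fun x => by rw [div_eq_mul_inv]
    exact tendsto_nat_floor_atTop.comp h1
  have hLt := hseq.comp hN
  -- log(c/x) → ∞
  have hlog : Tendsto (fun x : ℝ => Real.log (c / x)) (𝓝[>] 0) atTop := by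
    have h1 : Tendsto (fun x : ℝ => c / x) (𝓝[>] 0) atTop :=
      Tendsto.const_mul_atTop hc0 tendsto_inv_nhdsGT_zero |>.congr fun x => by rw [div_eq_mul_inv]
    exact Real.tendsto_log_atTop.comp h1
  have hbd : Tendsto (fun x : ℝ => 2 * B * Real.log 2 / Real.log (c / x)) (𝓝[>] 0) (𝓝 0) :=
    tendsto_const_nhds.div_atTop hlog
  -- the difference L(x) − L(t(x)) → 0
  have hdiff : Tendsto (fun x : ℝ => (∫ s in x..c, M s / s) / Real.log (c / x)
      - (∫ s in (L₀ / (((⌊L₀ / x⌋₊ : ℕ) : ℝ) + 1))..c, M s / s) / Real.log (c / (L₀ / (((⌊L₀ / x⌋₊ : ℕ) : ℝ) + 1))))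
      (𝓝[>] 0) (𝓝 0) := by
    refine squeeze_zero_norm' ?_ hbd
    filter_upwards [Ioo_mem_nhdsGT (show (0:ℝ) < min L₀ (c * Real.exp (-1)) from lt_min hL₀ (by positivity)),
      hlog.eventually_ge_atTop 1] with x hx hℓx
    obtain ⟨hx0, hx1⟩ := hx
    have hxL : x < L₀ := lt_of_lt_of_le hx1 (min_le_left _ _)
    have hxc : x < c * Real.exp (-1) := lt_of_lt_of_le hx1 (min_le_right _ _)
    set n : ℕ := ⌊L₀ / x⌋₊ with hn
    have hn1 : (0:ℝ) < (n:ℝ) + 1 := by positivity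
    have ht0 : 0 < L₀ / ((n:ℝ) + 1) := div_pos hL₀ hn1
    have htx : L₀ / ((n:ℝ) + 1) ≤ x := by
      rw [div_le_iff₀ hn1]
      have h1 := Nat.lt_floor_add_one (L₀ / x)
      rw [← hn, div_lt_iff₀ hx0] at h1
      linarith
    have hxt : x ≤ 2 * (L₀ / ((n:ℝ) + 1)) := by
      have hfl : (n:ℝ) ≤ L₀ / x := by rw [hn]; exact Nat.floor_le (by positivity)
      rw [le_div_iff₀ hx0] at hfl
      rw [mul_div_assoc', le_div_iff₀ hn1]
      nlinarith
    have h2pt := logScale_two_point hcont hB hcδ ht0 htx hxc.le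
    rw [Real.norm_eq_abs, abs_sub_comm]
    refine h2pt.trans ?_
    have hlogxt : Real.log (x / (L₀ / ((n:ℝ) + 1))) ≤ Real.log 2 :=
      Real.log_le_log (div_pos hx0 ht0) (by rwa [div_le_iff₀ ht0])
    have hℓ : Real.log (c / x) ≤ Real.log (c / (L₀ / ((n:ℝ) + 1))) :=
      Real.log_le_log (div_pos hc0 hx0) (div_le_div_of_nonneg_left hc0.le ht0 htx)
    have hℓx0 : 0 < Real.log (c / x) := by linarith
    have hnum : 0 ≤ 2 * B * Real.log 2 := mul_nonneg (by positivity) (Real.log_nonneg one_le_two)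
    calc 2 * B * Real.log (x / (L₀ / ((n:ℝ) + 1))) / Real.log (c / (L₀ / ((n:ℝ) + 1)))
        ≤ 2 * B * Real.log 2 / Real.log (c / (L₀ / ((n:ℝ) + 1))) :=
          div_le_div_of_nonneg_right (mul_le_mul_of_nonneg_left hlogxt (by positivity)) (by linarith)
      _ ≤ 2 * B * Real.log 2 / Real.log (c / x) := div_le_div_of_nonneg_left hnum hℓx0 hℓ
  have hsum := hLt.add hdiff
  rw [add_zero] at hsum
  exact hsum.congr fun x => by simp only [Function.comp_apply]; ring

/-- COROLLARY: **`L → m` at 0⁺ ⟺ `L(L₀∕(N+1)) → m`** — the log-scale average has a limit at 0⁺ iff it has one along the ideal clock. [folklore] -/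
theorem logScale_iff_idealClock (hcont : ContinuousOn M (Ioo 0 δ)) (hB : ∀ s ∈ Ioo 0 δ, |M s| ≤ B)
    (hL₀ : 0 < L₀) {c : ℝ} (hc0 : 0 < c) (hcδ : c < δ) (m : ℝ) :
    Tendsto (fun x => (∫ s in x..c, M s / s) / Real.log (c / x)) (𝓝[>] 0) (𝓝 m) ↔
      Tendsto (fun N : ℕ => (∫ s in (L₀ / ((N : ℝ) + 1))..c, M s / s) / Real.log (c / (L₀ / ((N : ℝ) + 1))))
        atTop (𝓝 m) := by
  obtain ⟨hipos, hiclock⟩ := escape_clock hL₀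
  exact ⟨fun hL => hL.comp (clock_nhdsWithin hipos hiclock),
    fun hseq => logScale_tendsto_of_idealClock hcont hB hL₀ hc0 hcδ hseq⟩

/-! ## §3 Any clock ⟺ the full limit at 0⁺ -/

/-- **END — THE TWO LOGARITHMIC AVERAGES ARE ONE.**  Let M be continuous on ]0, δ[ with `|M| ≤ B` and `|M u − M t| ≤ C·log(u∕t)`
(0 < t ≤ u < δ; C ≥ 0); let `h_n > 0` with the clock `n·h_n → L₀ > 0`; let `0 < c < δ`.  Then for every m:
**`(Σ_{n<N} M(h_n)∕(n+1))∕H_N → m  ⟺  (∫_h^c M ds∕s)∕log(c∕h) → m as h → 0⁺`** — the logarithmic cutoff average of the samples along ANY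
two-loop clock converges iff the log-scale average of M converges at 0⁺, to the same value (⟹: two clocks to the ideal one, §1 along it, §2
to 0⁺; ⟸: restrict to the couplings `h_N → 0⁺` and §1).  With P2 #54g∕#54j: both can happen without M having a limit. [folklore] -/
theorem logCutoffAverage_iff_logScaleAverage (hδ : 0 < δ) (hC : 0 ≤ C) (hcont : ContinuousOn M (Ioo 0 δ))
    (hlip : ∀ t u : ℝ, 0 < t → t ≤ u → u < δ → |M u - M t| ≤ C * Real.log (u / t))
    (hB : ∀ s ∈ Ioo 0 δ, |M s| ≤ B) {h : ℕ → ℝ} (hpos : ∀ n, 0 < h n) (hL₀ : 0 < L₀)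
    (hclock : Tendsto (fun n : ℕ => (n : ℝ) * h n) atTop (𝓝 L₀)) {c : ℝ} (hc0 : 0 < c) (hcδ : c < δ) (m : ℝ) :
    Tendsto (fun N : ℕ => (∑ n ∈ Finset.range N, ((n : ℝ) + 1)⁻¹ * M (h n)) / (∑ n ∈ Finset.range N, ((n : ℝ) + 1)⁻¹))
        atTop (𝓝 m) ↔
      Tendsto (fun x => (∫ s in x..c, M s / s) / Real.log (c / x)) (𝓝[>] 0) (𝓝 m) := by
  obtain ⟨hipos, hiclock⟩ := escape_clock hL₀
  constructor
  · intro hS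
    have hSi := (logCutoffAverage_clock_independent hδ hlip hpos hipos hL₀ hclock hiclock m).mp hS
    have hLi := (logCutoffAverage_iff_logScaleSeq hδ hC hcont hlip hB hipos hL₀ hiclock hc0 hcδ m).mp hSi
    exact logScale_tendsto_of_idealClock hcont hB hL₀ hc0 hcδ hLi
  · intro hL
    exact (logCutoffAverage_iff_logScaleSeq hδ hC hcont hlip hB hpos hL₀ hclock hc0 hcδ m).mpr
      (hL.comp (clock_nhdsWithin hpos hclock))

end

end Summit.QuantumFields.BalabanUV.Beta.EriceFlowEnclosureLogMeanClockIntegralEnd
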